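import Literature.NumberTheory.LFunctions.NoRealZeroUpTo
import Literature.NumberTheory.LFunctions.DirichletThetaTransformation
import Literature.NumberTheory.LFunctions.SiegelAbelSummation
import HarnessLib

/-!
# The completed `L`-function `ξ(σ, χ) = L(σ, χ) Γ((σ+κ)/2) (q/π)^{(σ+κ)/2}` on the real axis: rows
# `ξ(σ, χ_d) > 0` ARE the no-real-zero criterion (lineage A of a certified table)

Topic `Literature/NumberTheory/LFunctions`; namespace `Literature.NumberTheory.LFunctions`.
Everything here is PROVED (theorems only; no definition, no named fact).

A certified no-real-zero table computed from the theta / incomplete-Gamma representation (the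
method of Watkins, of Platt's rigorous `Λ`, and of this programme's lineage A) certifies, row by row,
`Λ_d(σ) := (|d|/π)^{(σ+a)/2} Γ((σ+a)/2) L(σ, χ_d) > 0` for `σ ∈ [0, 1]`, `a = charParity χ_d`. The tree's
`DirichletTheta.dirichletXi χ s = L(s, χ) Γ((s+κ)/2) (q/π)^{(s+κ)/2}` (Montgomery–Vaughan (10.19);
`dirichletXi_eq_LFunction_mul`) is exactly this `Λ_d`. On the positive real axis the Gamma and power
factors are POSITIVE REALS, so:

* `dirichletXi_ofReal_eq_LFunction_mul` — for `χ ≠ χ₀` and real `σ > 0`: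
  `ξ(σ, χ) = L(σ, χ) · G` with `G = Γ((σ+κ)/2) (q/π)^{(σ+κ)/2} > 0` real (`dirichletXi_ofReal_factor_pos`);
  `dirichletXi_ofReal_ne_zero_iff` (`ξ(σ, χ) ≠ 0 ↔ L(σ, χ) ≠ 0`), `dirichletXi_ofReal_re_pos_iff`
  (`Re ξ(σ, χ) > 0 ↔ Re L(σ, χ) > 0`);
* **rows ⇒ criterion**: `noRealZeroUpTo_of_dirichletXi_re_pos` — if `Re ξ(σ, χ) > 0` for every
  primitive quadratic `χ` mod `3 ≤ q ≤ Q` and every `σ ∈ (0, 1)`, then `NoRealZeroUpTo Q`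
  (`NoRealZeroUpTo.lean`); the narrow analogue `noExceptionalZeroUpTo_of_dirichletXi_re_pos`
  (rows on the window `[1 − c₀/log q, 1)` give `NoExceptionalZeroUpTo Q c₀`); and with `≠ 0` rows,
  `noRealZeroUpTo_of_dirichletXi_ne_zero`;
* **criterion ⇒ rows**: `NoRealZeroUpTo.dirichletXi_re_pos` — conversely a wide table gives
  `Re ξ(σ, χ) > 0` for all `σ > 0` (`L(σ, χ) > 0` by the intermediate value theorem from `L(1, χ) > 0`,
  tree `DirichletAbel.LFunction_ofReal_re_pos_of_forall_ne_zero`).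

## References

* H. L. Montgomery, R. C. Vaughan, *Multiplicative Number Theory I*, CUP 2007, §10.1 (10.15)–(10.19)
  and Theorem 10.6. [MontgomeryVaughan2007]
* M. Watkins, *Real zeros of real odd Dirichlet L-functions*, Math. Comp. 73 (2004) 415–423 (the
  `Λ`-positivity method). [Watkins2004RealZeros]
-/

noncomputable section

open Complex Literature.Barriers.Parity

namespace Literature.NumberTheory.LFunctions

open DirichletTheta DirichletAbel

variable {q : ℕ} [NeZero q] {χ : DirichletCharacter ℂ q}

/-! ### `ξ(σ, χ)` at real points `σ > 0` -/

omit [NeZero q] in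
/-- A real point `σ > 0` is not a trivial zero location: `σ + κ ≠ −2n`. [folklore] -/
private theorem ofReal_add_charParity_ne (χ : DirichletCharacter ℂ q) {σ : ℝ} (hσ : 0 < σ) (n : ℕ) :
    (σ : ℂ) + (charParity χ : ℂ) ≠ -(2 * n) := by
  intro h
  have := congrArg Complex.re h
  simp at this
  have hκ : (0 : ℝ) ≤ (charParity χ : ℝ) := Nat.cast_nonneg _
  have hn : (0 : ℝ) ≤ (n : ℝ) := Nat.cast_nonneg _
  linarith

/-- The Archimedean factor at a real point: `G(σ) = Γ((σ+κ)/2) (q/π)^{(σ+κ)/2} > 0` for `σ > 0`.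
[cite: MontgomeryVaughan2007, (10.19)] -/
theorem dirichletXi_ofReal_factor_pos (χ : DirichletCharacter ℂ q) {σ : ℝ} (hσ : 0 < σ) :
    0 < Real.Gamma ((σ + charParity χ) / 2) * ((q : ℝ) / Real.pi) ^ ((σ + charParity χ) / 2) := by
  have hκ : (0 : ℝ) ≤ (charParity χ : ℝ) := Nat.cast_nonneg _
  have hq : (0 : ℝ) < q := by exact_mod_cast NeZero.pos q
  exact mul_pos (Real.Gamma_pos_of_pos (by linarith)) (Real.rpow_pos_of_pos (div_pos hq Real.pi_pos) _)

/-- **`ξ(σ, χ) = L(σ, χ) · G(σ)` at real `σ > 0`** with the positive real factor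
`G(σ) = Γ((σ+κ)/2) (q/π)^{(σ+κ)/2}` (`χ ≠ χ₀`; (10.19) at a real point, where the Gamma factor is
finite). [cite: MontgomeryVaughan2007, (10.19)] -/
theorem dirichletXi_ofReal_eq_LFunction_mul (hχ : χ ≠ 1) {σ : ℝ} (hσ : 0 < σ) :
    dirichletXi χ σ = χ.LFunction σ *
      ((Real.Gamma ((σ + charParity χ) / 2) * ((q : ℝ) / Real.pi) ^ ((σ + charParity χ) / 2) : ℝ) : ℂ) := by
  rw [dirichletXi_eq_LFunction_mul hχ (ofReal_add_charParity_ne χ hσ), mul_assoc]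
  congr 1
  have hqπ : (0 : ℝ) ≤ (q : ℝ) / Real.pi := (div_pos (by exact_mod_cast NeZero.pos q) Real.pi_pos).le
  have harg : ((σ : ℂ) + (charParity χ : ℂ)) / 2 = (((σ + charParity χ) / 2 : ℝ) : ℂ) := by
    push_cast; ring
  rw [harg, Complex.Gamma_ofReal, Complex.ofReal_mul, Complex.ofReal_cpow hqπ]
  push_cast
  ring

/-- At a real point `σ > 0` (`χ ≠ χ₀`): `ξ(σ, χ) ≠ 0 ↔ L(σ, χ) ≠ 0`. [cite: MontgomeryVaughan2007, (10.19)] -/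
theorem dirichletXi_ofReal_ne_zero_iff (hχ : χ ≠ 1) {σ : ℝ} (hσ : 0 < σ) :
    dirichletXi χ σ ≠ 0 ↔ χ.LFunction σ ≠ 0 :=
  (dirichletXi_eq_zero_iff hχ (ofReal_add_charParity_ne χ hσ)).not

/-- At a real point `σ > 0` (`χ ≠ χ₀`): `Re ξ(σ, χ) = Re L(σ, χ) · G(σ)`, so `Re ξ(σ, χ) > 0 ↔ Re L(σ, χ) > 0`.
[cite: MontgomeryVaughan2007, (10.19)] -/
theorem dirichletXi_ofReal_re_pos_iff (hχ : χ ≠ 1) {σ : ℝ} (hσ : 0 < σ) :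
    0 < (dirichletXi χ σ).re ↔ 0 < (χ.LFunction σ).re := by
  have hG := dirichletXi_ofReal_factor_pos χ hσ
  rw [dirichletXi_ofReal_eq_LFunction_mul hχ hσ, Complex.re_mul_ofReal]
  constructor
  · intro h
    exact pos_of_mul_pos_left h hG.le
  · intro h
    exact mul_pos h hG

/-! ### Rows `ξ(σ, χ) > 0` give the criteria -/

/-- **Lineage-A rows are a wide table.** If `Re ξ(σ, χ) > 0` for every modulus `3 ≤ q ≤ Q`, every
primitive quadratic `χ` mod `q` and every `σ ∈ (0, 1)`, then `NoRealZeroUpTo Q`.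
[cite: MontgomeryVaughan2007, (10.19)] -/
theorem noRealZeroUpTo_of_dirichletXi_re_pos {Q : ℕ}
    (h : ∀ (q : ℕ) [NeZero q], 3 ≤ q → q ≤ Q → ∀ χ : DirichletCharacter ℂ q, χ.IsQuadratic →
      χ.IsPrimitive → ∀ σ : ℝ, 0 < σ → σ < 1 → 0 < (dirichletXi χ σ).re) :
    NoRealZeroUpTo Q := by
  intro q _ hq3 hqQ χ hquad hprim σ hσ0 hσ1 h0
  have hne : χ ≠ 1 := SiegelZeroQuality.ne_one_of_isPrimitive hprim (by omega)
  have := (dirichletXi_ofReal_re_pos_iff hne hσ0).mp (h q hq3 hqQ χ hquad hprim σ hσ0 hσ1)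
  rw [h0, Complex.zero_re] at this
  exact lt_irrefl _ this

/-- Rows `ξ(σ, χ) ≠ 0` (any certified sign) on `(0, 1)` give `NoRealZeroUpTo Q` as well.
[cite: MontgomeryVaughan2007, (10.19)] -/
theorem noRealZeroUpTo_of_dirichletXi_ne_zero {Q : ℕ}
    (h : ∀ (q : ℕ) [NeZero q], 3 ≤ q → q ≤ Q → ∀ χ : DirichletCharacter ℂ q, χ.IsQuadratic →
      χ.IsPrimitive → ∀ σ : ℝ, 0 < σ → σ < 1 → dirichletXi χ σ ≠ 0) :
    NoRealZeroUpTo Q := by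
  intro q _ hq3 hqQ χ hquad hprim σ hσ0 hσ1
  have hne : χ ≠ 1 := SiegelZeroQuality.ne_one_of_isPrimitive hprim (by omega)
  exact (dirichletXi_ofReal_ne_zero_iff hne hσ0).mp (h q hq3 hqQ χ hquad hprim σ hσ0 hσ1)

/-- **Narrow form**: rows `Re ξ(σ, χ) > 0` on the window `σ ∈ (0, 1)`, `1 − c₀/log q ≤ σ`, for every
primitive quadratic `χ` mod `3 ≤ q ≤ Q` give `NoExceptionalZeroUpTo Q c₀` (at `σ = 1`, `L(1, χ) ≠ 0`).
[cite: MontgomeryVaughan2007, (10.19)] -/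
theorem noExceptionalZeroUpTo_of_dirichletXi_re_pos {Q : ℕ} {c₀ : ℝ}
    (h : ∀ (q : ℕ) [NeZero q], 3 ≤ q → q ≤ Q → ∀ χ : DirichletCharacter ℂ q, χ.IsQuadratic →
      χ.IsPrimitive → ∀ σ : ℝ, 0 < σ → 1 - c₀ / Real.log q ≤ σ → σ < 1 → 0 < (dirichletXi χ σ).re) :
    NoExceptionalZeroUpTo Q c₀ := by
  intro q _ hq3 hqQ χ hquad hprim σ hσ0 hσ hσ1 h0
  have hne : χ ≠ 1 := SiegelZeroQuality.ne_one_of_isPrimitive hprim (by omega)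
  rcases eq_or_lt_of_le hσ1 with rfl | hlt
  · exact DirichletCharacter.LFunction_ne_zero_of_one_le_re χ (Or.inl hne) (by simp) h0
  · have := (dirichletXi_ofReal_re_pos_iff hne hσ0).mp (h q hq3 hqQ χ hquad hprim σ hσ0 hσ hlt)
    rw [h0, Complex.zero_re] at this
    exact lt_irrefl _ this

/-! ### The criterion gives the rows -/

/-- **Conversely, a wide table makes every `ξ(σ, χ)` positive**: under `NoRealZeroUpTo Q`, for every
quadratic `χ ≠ χ₀` mod `q ≤ Q` and every `σ > 0`, `Re ξ(σ, χ) > 0` (`L(σ, χ) > 0` on `(0, ∞)` by the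
intermediate value theorem from `L(1, χ) > 0`, and `G(σ) > 0`). [cite: MontgomeryVaughan2007, (10.19)] -/
theorem NoRealZeroUpTo.dirichletXi_re_pos {Q : ℕ} (h : NoRealZeroUpTo Q) {q : ℕ} [NeZero q]
    (hqQ : q ≤ Q) (χ : DirichletCharacter ℂ q) (hquad : χ.IsQuadratic) (hχ : χ ≠ 1) {σ : ℝ}
    (hσ0 : 0 < σ) : 0 < (dirichletXi χ σ).re := by
  have hsq : χ ^ 2 = 1 := MulChar.isQuadratic_iff_sq_eq_one.mp hquad
  refine (dirichletXi_ofReal_re_pos_iff hχ hσ0).mpr ?_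
  rcases le_or_gt σ 1 with h1 | h1
  · exact LFunction_ofReal_re_pos_of_forall_ne_zero χ hχ hsq hσ0 h1
      fun _ h1' _ ↦ h.lfunction_ne_zero hqQ χ hquad hχ (hσ0.trans_le h1')
  · exact LFunction_ofReal_re_pos_of_one_lt χ hsq h1

/-- **Equivalence**: `NoRealZeroUpTo Q` iff every row `Re ξ(σ, χ) > 0`, `χ` primitive quadratic mod
`3 ≤ q ≤ Q`, `σ ∈ (0, 1)`, holds. [cite: MontgomeryVaughan2007, (10.19)] -/
theorem noRealZeroUpTo_iff_dirichletXi_re_pos {Q : ℕ} :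
    NoRealZeroUpTo Q ↔
      ∀ (q : ℕ) [NeZero q], 3 ≤ q → q ≤ Q → ∀ χ : DirichletCharacter ℂ q, χ.IsQuadratic →
        χ.IsPrimitive → ∀ σ : ℝ, 0 < σ → σ < 1 → 0 < (dirichletXi χ σ).re :=
  ⟨fun h q _ _ hqQ χ hquad hprim σ hσ0 _ ↦
      h.dirichletXi_re_pos hqQ χ hquad (SiegelZeroQuality.ne_one_of_isPrimitive hprim (by omega)) hσ0,
    noRealZeroUpTo_of_dirichletXi_re_pos⟩

end Literature.NumberTheory.LFunctions

end
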